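import Literature.Computability.Complexity.IrreducibilityLLLDecideFP
import Literature.Computability.Complexity.NumberFieldIsomorphism
import Literature.Computability.Complexity.CanonicalCodes
import Literature.Computability.Complexity.LengthCompare
import HarnessLib

/-!
# Irreducibility of monic integer polynomials is decidable in `P` (Lenstra–Lenstra–Lovász 1982)

Discharge of the named fact `Literature.Computability.Complexity.lll_monicIrreducible_mem_P`
(`NumberFieldIsomorphism.lean`): the language `MonicIrreducibleLang` of strings reading as a monic
irreducible integer polynomial is in `P`.

Proof (LLL82 §3, specialised to the decision problem; files `IrreducibilityLLL*.lean`): a string `w`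
ALWAYS decodes (`encodingIntBool.listBool.decode` is total, `CanonCode.canonListFn_eq`) to a list
`decCoeffs w`, read as the polynomial `polyOfList (decCoeffs w) = ofCoeffs (decCoeffs w)`; the test
`irredTest` (`IrreducibilityLLLDecide.lean`: trimming and monicity, the prime of (3.6), Berlekamp
(3.1), Hensel (3.2), the lattice of (2.3) reduced by the tree's LLL machine (3.3)–(3.4), the length
test (3.5)) is CORRECT (`irredTest_eq_true_iff`, from Prop. (2.13) `irreducible_iff_testBound_lt`) and
runs in polynomial time on list codes (`irredTestC`, `IrreducibilityLLLDecideFP.lean`); composing with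
the polynomial-time canonicaliser `canonListFn canonIntFn` (any string ↦ the code of the list it
decodes to) gives a polynomial-time decider (`mem_P_of_mem_FP`).

* `polyOfList_eq_ofCoeffs`, `decCoeffs`, `decode_eq_decCoeffs`, `canonListFn_eq_listE`,
  `mem_monicIrreducibleLang_iff`;
* **`lll_monicIrreducible_mem_P_holds : lll_monicIrreducible_mem_P`**.

## References

* A. K. Lenstra, H. W. Lenstra Jr., L. Lovász, *Factoring polynomials with rational coefficients*,
  Math. Ann. 261 (1982) 515–534, §3, Thm. (3.6) (polynomial-time factorisation of primitive integer
  polynomials; a monic `f` is irreducible iff the algorithm returns `f` itself). [LenstraLenstraLovasz1982]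
* M. R. Bremner, *Lattice Basis Reduction*, CRC Press 2011, §15.7. [Bremner2011]
* S. Arora, B. Barak, *Computational Complexity: A Modern Approach*, CUP 2009, §1.3. [AroraBarak2009]
-/

noncomputable section

namespace Literature.Computability.Complexity

open Polynomial SumcheckMA CodeFP Brick _root_.Computability CanonCode

namespace LLLFactoring

/-! ### Reading strings -/

/-- **The route's reading is the list polynomial**: `polyOfList l = ofCoeffs l`. [folklore] -/
theorem polyOfList_eq_ofCoeffs (l : List ℤ) : polyOfList l = ofCoeffs l := by
  ext j
  rw [coeff_ofCoeffs, polyOfList, finsetSum_coeff]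
  simp only [coeff_monomial]
  by_cases hj : j < l.length
  · rw [Finset.sum_eq_single ⟨j, hj⟩ (fun i _ hi => if_neg fun h => hi (Fin.ext h)) (fun h => absurd (Finset.mem_univ _) h),
      if_pos rfl, List.getD_eq_getElem?_getD, List.getElem?_eq_getElem hj, Option.getD_some, List.get_eq_getElem]
  · rw [Finset.sum_eq_zero, List.getD_eq_getElem?_getD, List.getElem?_eq_none (not_lt.1 hj), Option.getD_none]
    intro i _
    rw [if_neg]
    intro h
    exact hj (h ▸ i.isLt)

/-- The integer list read off ANY string by the (total) decoder of `encodingIntBool.listBool`. [folklore] -/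
def decCoeffs (w : List Bool) : List ℤ := NegCNF.decList decInt (boolUnpair w).1.length (boolUnpair w).2

/-- The decoder is total with value `decCoeffs`. [folklore] -/
theorem decode_eq_decCoeffs (w : List Bool) : encodingIntBool.listBool.decode w = some (decCoeffs w) :=
  (canonListFn_eq encodingIntBool decInt decode_int canonIntFn_eq w).1

/-- The canonicaliser re-encodes: `canonListFn canonIntFn w = listE smE (decCoeffs w)`. [folklore] -/
theorem canonListFn_eq_listE (w : List Bool) : canonListFn canonIntFn w = listE smE (decCoeffs w) := by
  rw [(canonListFn_eq encodingIntBool decInt decode_int canonIntFn_eq w).2, listE_eq]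
  rfl

/-- **Membership in `MonicIrreducibleLang` is the test on the decoded list.**
[cite: LenstraLenstraLovasz1982, (3.6)] -/
theorem mem_monicIrreducibleLang_iff (w : List Bool) : w ∈ MonicIrreducibleLang ↔ irredTest (decCoeffs w) = true := by
  rw [irredTest_eq_true_iff, ← polyOfList_eq_ofCoeffs]
  show (∃ p : Polynomial ℤ, polyDecode w = some p ∧ p.Monic ∧ Irreducible p) ↔ _
  rw [polyDecode, decode_eq_decCoeffs, Option.map_some]
  constructor
  · rintro ⟨p, hp, hm, hi⟩
    rw [Option.some.injEq] at hp
    rw [hp]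
    exact ⟨hm, hi⟩
  · rintro ⟨hm, hi⟩
    exact ⟨_, rfl, hm, hi⟩

end LLLFactoring

open LLLFactoring in
/-- **Discharge of `lll_monicIrreducible_mem_P` (Lenstra–Lenstra–Lovász 1982, §3, Thm. (3.6)):
`MonicIrreducibleLang ∈ P`.** The decider is `F ∘ canonListFn canonIntFn`, `F` the polynomial-time
realisation of `irredTest` (`irredTestC`): on every string it answers `[irredTest (decCoeffs w)]`,
which is `[true]` exactly on the language (`mem_monicIrreducibleLang_iff`, i.e. the correctness
theorem `irredTest_eq_true_iff` of the LLL test). [cite: LenstraLenstraLovasz1982, §3 Thm. (3.6)] [cite: Bremner2011, §15.7] -/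
theorem lll_monicIrreducible_mem_P_holds : lll_monicIrreducible_mem_P := by
  obtain ⟨F, hF, hFe⟩ := irredTestC
  unfold lll_monicIrreducible_mem_P
  refine mem_P_of_mem_FP (g := F ∘ canonListFn canonIntFn)
    (comp_mem_FP hF (canonListFn_mem_FP canonIntFn_mem_FP length_canonIntFn_le)) MonicIrreducibleLang fun w => ?_
  have hval : (F ∘ canonListFn canonIntFn) w = [irredTest (decCoeffs w)] := by
    rw [Function.comp_apply, canonListFn_eq_listE, hFe]; rfl
  rw [hval, mem_monicIrreducibleLang_iff]
  refine ⟨fun h => by rw [h], fun h => ?_⟩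
  rw [Bool.not_eq_true] at h
  rw [h]

end Literature.Computability.Complexity
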